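import Summits.KontsevichZagierPeriods.Zeta5Search.LaiSweepShard

/-!
# `κ₃` sweep certificate — shard file 111 of 127 (shards 777–783 of 889)

HONEST FRAMING. Systematic search; no irrationality claim unless certified. This file only checks,
by `decide +kernel`, shards 777–783 of the order-cell sweep of the `κ₃` point `(74, 2180, 444; δ74)`
(engine `LaiSweepEngine`, soundness `LaiSweepJump/Free/Eval/Shard/Kappa3`; a shard is `⟨regime, n,
p, q, p', q', Lo, Up⟩`: `n` cells from `p/q` to `p'/q'` with integer rate sums in `[Lo, Up]`, `K =
128`, `D = 2^40`). It draws NO conclusion: only the capstone `LaiKappa3SweepCert`, which needs all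
127 shard files, does. Kernel cost of this file ≈ 560 cells × 0.3 s.
-/

namespace Summit.KontsevichZagierPeriods.Zeta5Search.Sweep

set_option maxHeartbeats 100000000 in
/-- Shard 777: 80 cells of regime B from `251/292` to `266/309`.
[cite: Lai2024BallRivoal, §4 Lemma 4.3] -/
theorem shard777 :
    Shard.check 128 (2^40)
      ⟨true, 80, 251, 292, 266, 309, 10672768801829, 17445830112628⟩ = true := by
  decide +kernel

set_option maxHeartbeats 100000000 in
/-- Shard 778: 80 cells of regime B from `266/309` to `369/428`.
[cite: Lai2024BallRivoal, §4 Lemma 4.3] -/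
theorem shard778 :
    Shard.check 128 (2^40)
      ⟨true, 80, 266, 309, 369, 428, 11139037471149, 18227394336074⟩ = true := by
  decide +kernel

set_option maxHeartbeats 100000000 in
/-- Shard 779: 80 cells of regime B from `369/428` to `259/300`.
[cite: Lai2024BallRivoal, §4 Lemma 4.3] -/
theorem shard779 :
    Shard.check 128 (2^40)
      ⟨true, 80, 369, 428, 259, 300, 10074610258727, 16502615210033⟩ = true := by
  decide +kernel

set_option maxHeartbeats 100000000 in
/-- Shard 780: 80 cells of regime B from `259/300` to `281/325`.
[cite: Lai2024BallRivoal, §4 Lemma 4.3] -/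
theorem shard780 :
    Shard.check 128 (2^40)
      ⟨true, 80, 259, 300, 281, 325, 10896788703177, 17867735988630⟩ = true := by
  decide +kernel

set_option maxHeartbeats 100000000 in
/-- Shard 781: 80 cells of regime B from `281/325` to `342/395`.
[cite: Lai2024BallRivoal, §4 Lemma 4.3] -/
theorem shard781 :
    Shard.check 128 (2^40)
      ⟨true, 80, 281, 325, 342, 395, 10259795532996, 16840567706392⟩ = true := by
  decide +kernel

set_option maxHeartbeats 100000000 in
/-- Shard 782: 80 cells of regime B from `342/395` to `359/414`.
[cite: Lai2024BallRivoal, §4 Lemma 4.3] -/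
theorem shard782 :
    Shard.check 128 (2^40)
      ⟨true, 80, 342, 395, 359, 414, 11261541940247, 18504378477926⟩ = true := by
  decide +kernel

set_option maxHeartbeats 100000000 in
/-- Shard 783: 80 cells of regime B from `359/414` to `343/395`.
[cite: Lai2024BallRivoal, §4 Lemma 4.3] -/
theorem shard783 :
    Shard.check 128 (2^40)
      ⟨true, 80, 359, 414, 343, 395, 10219298682307, 16809361730227⟩ = true := by
  decide +kernel

/-- The checked shards of this file, in order. [folklore] -/
def shards111 : List (CheckedShard 128 (2^40)) :=
  [⟨_, shard777⟩, ⟨_, shard778⟩, ⟨_, shard779⟩, ⟨_, shard780⟩, ⟨_, shard781⟩,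
    ⟨_, shard782⟩, ⟨_, shard783⟩]

end Summit.KontsevichZagierPeriods.Zeta5Search.Sweep
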